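import Mathlib
import HarnessLib
import Summits.NavierStokesRegularity.NavierStokesRegularity.Theorems.TypeILiouvilleLambTailExpDecay

/-!
# TypeILiouvilleLambTailStubs — crux (L) stmt-NavierStokesRegularity-10661 `TypeIliouvilleL`:
# THE EXPONENTIALLY-BELTRAMI STRATUM IS EMPTY IN ALL THREE REGISTERED REGIMES (part 6 of `TypeILiouvilleLambTail`)

Helper for stmt-NavierStokesRegularity-10661 (`--supports`); theorems only, no definitions, no named-fact
hypotheses; closes no item; Navier–Stokes regularity is NOT proved here (leafhand seat of the EulerZoomLiouville route).

Part 5 proved, unconditionally: a member of print's class P whose vortex commutator `Dv[ω] − Dω[v] = curl(v × ω)`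
is `O(e^{μτ})` as `τ → −∞` for SOME `μ > 0` is one constant vector (`const_of_commutator_exp_decay`).  This file
restates that cell on the three registered stubs of the (L) skeleton, binders VERBATIM plus the stratum hypothesis:

* `typeI_eq_zero_of_commutator_exp_decay` / `typeIAncientLiouville_onExpBeltrami` — the TYPE-I DOOR
  (`stub_typeIAncientLiouville_knssGauge` = stmt-4050, the load-bearing stub): a KNSS-gauge Type-I ancient mild field
  with exponentially decaying vortex commutator VANISHES (each backward shift is a class-P member of the stratum, hence a
  constant `b_δ`; the Type-I bound kills `b_δ`).
* `quiescentLiouville_onExpBeltrami` — L_Q (`stub_quiescentLiouville`) on the stratum (quiescence hypothesis idle).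
* `persistentMild_onExpBeltrami` — S3ᵐ (`stub_persistent_mild_backward_L3_recurrence`) on the stratum: the flow is a
  constant `b`, so it is `L³`-close (norm `0`) to `b` along `τ_k = −(k+1)` (persistence hypothesis idle).

HONEST LABEL: by-name instances of a classical sector; nothing here proves a registered stub, (L), or Navier–Stokes
regularity; rung 0.
[cite: KochNadirashviliSereginSverak2009, §4 (i) p. 8, (1.4), Remark 6.1 (arXiv:0709.3599)] [cite: MajdaBertozziCUP2002, §2.3]
-/

noncomputable section
open MeasureTheory Filter Set Function Metric
open scoped Topology ENNReal RealInnerProductSpace Laplacian ContDiff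
open Literature.Analysis Literature.Analysis.FluidPDE Literature.Analysis.UnboundedOperators
set_option linter.dupNamespace false
namespace Summit.NavierStokesRegularity.NavierStokesRegularity.Theorems.TypeILiouvilleLambTail

/-- **A KNSS-gauge Type-I ancient mild field with exponentially decaying vortex commutator vanishes identically.**
For `δ > 0` the backward shift `W(· − δ)` is a class-P flow (`TypeILiouvilleTypeIDoorLocalAxis.typeI_shift_classP`)
whose commutator is `≤ (A e^{−μδ}) e^{μt}`, hence one constant `b_δ` (`const_of_commutator_exp_decay`);
`‖b_δ‖ ≤ C/√(−t)` for `t < −δ` forces `b_δ = 0`.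
[cite: KochNadirashviliSereginSverak2009, §4 (i) p. 8 and (1.4) (arXiv:0709.3599)] -/
theorem typeI_eq_zero_of_commutator_exp_decay {C : ℝ}
    {W : ℝ → EuclideanSpace ℝ (Fin 3) → EuclideanSpace ℝ (Fin 3)} (hW : IsTypeIAncientMild C W)
    {μ A : ℝ} (hμ : 0 < μ)
    (hA : ∀ t < 0, ∀ x : EuclideanSpace ℝ (Fin 3),
      ‖fderiv ℝ (W t) x (curl (W t) x) - fderiv ℝ (curl (W t)) x (W t x)‖ ≤ A * Real.exp (μ * t)) :
    ∀ t < 0, ∀ x, W t x = 0 := by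
  have hshift : ∀ δ : ℝ, 0 < δ → ∃ b : EuclideanSpace ℝ (Fin 3), ∀ t < 0, ∀ x, W (t - δ) x = b := by
    intro δ hδ
    obtain ⟨hc, hK, hm⟩ := TypeILiouvilleTypeIDoorLocalAxis.typeI_shift_classP hW hδ
    have hsm : ContDiffOn ℝ (⊤ : ℕ∞) (uncurry W) (Iio 0 ×ˢ univ) := hW.1
    have hd : ∀ t < 0, IsWeaklyDivFree ((fun t x => W (t - δ) x) t) := by
      intro t ht
      have ht' : t - δ < 0 := by linarith
      have hslice : ContDiff ℝ (⊤ : ℕ∞) (W (t - δ)) := by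
        have hι : ContDiff ℝ (⊤ : ℕ∞)
            (fun x : EuclideanSpace ℝ (Fin 3) => ((t - δ, x) : ℝ × EuclideanSpace ℝ (Fin 3))) :=
          contDiff_const.prodMk contDiff_id
        exact hsm.comp_contDiff hι fun x => ⟨ht', mem_univ _⟩
      exact VectorCalculus.IsDivFree.isWeaklyDivFree_holds (hW.2.1 _ ht')
        (hslice.of_le (by exact_mod_cast le_top))
    have hA' : ∀ t < 0, ∀ x : EuclideanSpace ℝ (Fin 3),
        ‖fderiv ℝ ((fun t x => W (t - δ) x) t) x (curl ((fun t x => W (t - δ) x) t) x) -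
          fderiv ℝ (curl ((fun t x => W (t - δ) x) t)) x ((fun t x => W (t - δ) x) t x)‖ ≤
          (A * Real.exp (-(μ * δ))) * Real.exp (μ * t) := by
      intro t ht x
      have h := hA (t - δ) (by linarith) x
      have heq : A * Real.exp (μ * (t - δ)) = (A * Real.exp (-(μ * δ))) * Real.exp (μ * t) := by
        rw [mul_sub, sub_eq_add_neg, Real.exp_add]; ring
      rw [heq] at h
      exact h
    exact const_of_commutator_exp_decay hc hK hd hm hμ hA'
  have hlim : Tendsto (fun t : ℝ => C / Real.sqrt (-t)) atBot (𝓝 0) :=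
    tendsto_const_nhds.div_atTop (Real.tendsto_sqrt_atTop.comp tendsto_neg_atBot_atTop)
  intro t ht x
  obtain ⟨b, hb⟩ := hshift (-t / 2) (by linarith)
  have hb' : ∀ s < -(-t / 2), ∀ y, W s y = b := fun s hs y => by
    have := hb (s + -t / 2) (by linarith) y; rwa [add_sub_cancel_right] at this
  have hnorm : ∀ᶠ s in atBot, ‖b‖ ≤ C / Real.sqrt (-s) := by
    filter_upwards [eventually_lt_atBot (-(-t / 2))] with s hs
    rw [← hb' s hs 0]; exact hW.norm_le (by linarith) 0
  have hb0 : b = 0 := norm_le_zero_iff.1 (ge_of_tendsto hlim hnorm)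
  rw [hb' t (by linarith) x, hb0]

/-- **The Type-I door on the exponentially-Beltrami stratum, binders VERBATIM** (`stub_typeIAncientLiouville_knssGauge`
of the (L) skeleton = `Theses.SymmetryModuliCount.TypeIAncientLiouville`, stmt-4050): a smooth, divergence-free,
Oseen-kernel-mild, Type-I-in-time field on `(−∞,0) × ℝ³` whose vortex commutator is `O(e^{μt})` (some `μ > 0`)
vanishes identically. [cite: KochNadirashviliSereginSverak2009, §4 (i) p. 8 and (1.4) (arXiv:0709.3599)] -/
theorem typeIAncientLiouville_onExpBeltrami :
    ∀ (C : ℝ) (u : ℝ → EuclideanSpace ℝ (Fin 3) → EuclideanSpace ℝ (Fin 3)),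
      ContDiffOn ℝ (⊤ : ℕ∞) (Function.uncurry u) (Set.Iio 0 ×ˢ Set.univ) ∧
      (∀ t < 0, Literature.Analysis.FluidPDE.VectorCalculus.IsDivFree (u t)) ∧
      (∀ s t : ℝ, s < t → t < 0 → ∀ x,
        u t x = Literature.Analysis.FluidPDE.heatFlow (u s) (t - s) x -
          ∫ τ in Set.Ioo s t, ∫ y,
            Literature.Analysis.FluidPDE.oseenKernel (t - τ) (x - y) (u τ y) (u τ y)) ∧
      Literature.Analysis.FluidPDE.HasTypeITimeDecay C u →
      (∃ μ A : ℝ, 0 < μ ∧ ∀ t < 0, ∀ x : EuclideanSpace ℝ (Fin 3),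
        ‖fderiv ℝ (u t) x (curl (u t) x) - fderiv ℝ (curl (u t)) x (u t x)‖ ≤ A * Real.exp (μ * t)) →
      ∀ t < 0, ∀ x, u t x = 0 := by
  intro C u hu hexp
  obtain ⟨μ, A, hμ, hA⟩ := hexp
  exact typeI_eq_zero_of_commutator_exp_decay (isTypeIAncientMild_iff.2 hu) hμ hA

/-- **L_Q (registered `stub_quiescentLiouville`) HOLDS on the exponentially-Beltrami stratum** — binders of the stub
verbatim plus the stratum hypothesis; the quiescence hypothesis is not used (part 5 is unconditional).
[cite: KochNadirashviliSereginSverak2009, §4 (i), Remark 6.1 (arXiv:0709.3599)] -/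
theorem quiescentLiouville_onExpBeltrami :
    ∀ v : ℝ → EuclideanSpace ℝ (Fin 3) → EuclideanSpace ℝ (Fin 3),
      ContinuousOn (Function.uncurry v) (Set.Iio 0 ×ˢ Set.univ) →
      (∃ K : ℝ, ∀ t < 0, ∀ x, ‖v t x‖ ≤ K) →
      (∀ t < 0, Literature.Analysis.FluidPDE.IsWeaklyDivFree (v t)) →
      (∀ s t : ℝ, s < t → t < 0 → ∀ x,
        v t x = Literature.Analysis.UnboundedOperators.heatExtension (v s) (t - s) x -
          Literature.Analysis.FluidPDE.oseenDuhamel 1 s v v t x) →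
      (∀ ε : ℝ, 0 < ε → ∃ T : ℝ, T < 0 ∧ ∀ t < T, ∀ x y : EuclideanSpace ℝ (Fin 3),
        dist x y ≤ 1 → ‖v t x - v t y‖ ≤ ε) →
      (∃ μ A : ℝ, 0 < μ ∧ ∀ t < 0, ∀ x : EuclideanSpace ℝ (Fin 3),
        ‖fderiv ℝ (v t) x (curl (v t) x) - fderiv ℝ (curl (v t)) x (v t x)‖ ≤ A * Real.exp (μ * t)) →
      ∃ b : EuclideanSpace ℝ (Fin 3), ∀ t < 0, ∀ x, v t x = b := by
  intro v hc hK hd hm _ hexp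
  obtain ⟨μ, A, hμ, hA⟩ := hexp
  exact const_of_commutator_exp_decay hc hK hd hm hμ hA

/-- **S3ᵐ (registered `stub_persistent_mild_backward_L3_recurrence`) HOLDS on the exponentially-Beltrami stratum**: the
flow is one constant `b`, so `v(τ_k) − b ≡ 0` has `L³` norm `0 ≤ M` along `τ_k = −(k+1)`; persistence is not used.
[cite: KochNadirashviliSereginSverak2009, §4 (i), Remark 6.1 (arXiv:0709.3599)] -/
theorem persistentMild_onExpBeltrami :
    ∀ v : ℝ → EuclideanSpace ℝ (Fin 3) → EuclideanSpace ℝ (Fin 3),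
      ContinuousOn (uncurry v) (Iio 0 ×ˢ univ) →
      (∃ K : ℝ, ∀ t < 0, ∀ x, ‖v t x‖ ≤ K) →
      (∀ t < 0, Literature.Analysis.FluidPDE.IsWeaklyDivFree (v t)) →
      (∀ s t : ℝ, s < t → t < 0 → ∀ x,
        v t x = Literature.Analysis.UnboundedOperators.heatExtension (v s) (t - s) x -
          Literature.Analysis.FluidPDE.oseenDuhamel 1 s v v t x) →
      (¬ ∃ C : ℝ, ∀ t < 0, ∀ x, ‖v t x‖ ≤ C / Real.sqrt (-t)) →
      (∃ μ A : ℝ, 0 < μ ∧ ∀ t < 0, ∀ x : EuclideanSpace ℝ (Fin 3),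
        ‖fderiv ℝ (v t) x (curl (v t) x) - fderiv ℝ (curl (v t)) x (v t x)‖ ≤ A * Real.exp (μ * t)) →
      ∃ (b : ℕ → EuclideanSpace ℝ (Fin 3)) (τ : ℕ → ℝ) (M : NNReal),
        (∀ k, τ k < 0) ∧ Tendsto τ atTop atBot ∧
        ∀ k, eLpNorm (fun x => v (τ k) x - b k) 3
          (volume : Measure (EuclideanSpace ℝ (Fin 3))) ≤ (M : ENNReal) := by
  intro v hc hK hd hm _ hexp
  obtain ⟨μ, A, hμ, hA⟩ := hexp
  obtain ⟨b, hb⟩ := const_of_commutator_exp_decay hc hK hd hm hμ hA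
  have hneg : ∀ k : ℕ, -((k : ℝ) + 1) < 0 := fun k => by
    have : (0 : ℝ) < (k : ℝ) + 1 := by positivity
    linarith
  refine ⟨fun _ => b, fun k => -((k : ℝ) + 1), 0, hneg, ?_, fun k => ?_⟩
  · exact tendsto_neg_atTop_atBot.comp
      (tendsto_atTop_add_const_right _ _ tendsto_natCast_atTop_atTop)
  · have hzero : (fun x => v (-((k : ℝ) + 1)) x - b) = fun _ => 0 := by
      funext x; rw [hb _ (hneg k) x, sub_self]
    rw [hzero, eLpNorm_zero']
    exact bot_le

end Summit.NavierStokesRegularity.NavierStokesRegularity.Theorems.TypeILiouvilleLambTail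

end
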